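import Summits.ResolutionOfSingularities.ResolutionOfSingularities.Theorems.FrobeniusLadderFInjectiveMacaulayficationPencilFedderRegularBase
import HarnessLib

/-!
# FULL of `B[X]/(uX − v)` at every prime over `𝔪`: the two-coefficient Fedder test split into UNIT POINTS and the POLE
# (BED Ω₁ GLOBAL PATCH, F6 v2 §2, sequel of ✓ `PencilFedderRegularBase`: the form the per-code recipes ✓ `PencilCodeFedder` feed, for the `W`-chart `(u, v)` and the `U`-chart `(v, u)` alike;
# crux `FInjectiveMacaulayfication` stmt-ResolutionOfSingularities-15315, chain w45a; seat res-L1-w45a-stub-3 g15)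

[OURS · L1 W4.5a] Support file (`--supports stmt-ResolutionOfSingularities-15315 --as helper`); theorems only; GENERIC; no named fact; NOT a statement of any manuscript; nothing of the
crux is proved. AI-written (AI review is weaker than expert review).
* `pointIdeal_congr` — `𝔪B[X] + (X − w₀)` depends only on `w₀ mod 𝔪`; `fedder_pole_iff` — at the pole the test reads `v^(p−1) ∉ 𝔪^[p] ∨ u^(p−1) ∉ 𝔪^[p]`;
* ★★ `fullCl_localization_pencilQuot_of_over'` — `B` regular local of characteristic `p` with algebraically closed residue field, `u, v ∈ 𝔪`, `B[X]/(uX − v)` a domain, the test at the unit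
  points and at the pole ⇒ `FullCl p` at every prime over `𝔪`.
[cite: Fedder1983, Prop. 1.7, Thm. 1.12]
-/

set_option linter.dupNamespace false

noncomputable section

namespace Summit.ResolutionOfSingularities.ResolutionOfSingularities.Theorems.FInjectiveMacaulayfication.PencilFedderRegularBasePole

open IsLocalRing Polynomial Literature.RingTheory.TightClosure Literature.AlgebraicGeometry.Resolution
open Summit.ResolutionOfSingularities.ResolutionOfSingularities.Theorems.FInjectiveMacaulayfication SliceableCentre PencilFedderRegularBase

variable (p : ℕ) [Fact p.Prime] {B : Type} [CommRing B] [IsRegularLocalRing B] [CharP B p]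

omit [IsRegularLocalRing B] [CharP B p] in
/-- The point ideal only depends on the residue class of `w₀`. [plumbing] -/
theorem pointIdeal_congr [IsLocalRing B] (w₀ w₁ : B) (h : w₀ - w₁ ∈ maximalIdeal B) :
    (maximalIdeal B).map (C : B →+* B[X]) ⊔ Ideal.span {X - C w₀} = (maximalIdeal B).map (C : B →+* B[X]) ⊔ Ideal.span {X - C w₁} := by
  have key : ∀ a b : B, a - b ∈ maximalIdeal B →
      (maximalIdeal B).map (C : B →+* B[X]) ⊔ Ideal.span {X - C a} ≤ (maximalIdeal B).map (C : B →+* B[X]) ⊔ Ideal.span {X - C b} := by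
    intro a b hab
    refine sup_le le_sup_left ((Ideal.span_singleton_le_iff_mem _).mpr ?_)
    have : (X : B[X]) - C a = (X - C b) - C (a - b) := by rw [map_sub]; ring
    rw [this]
    exact Ideal.sub_mem _ (Ideal.mem_sup_right (Ideal.mem_span_singleton_self _)) (Ideal.mem_sup_left (Ideal.mem_map_of_mem _ hab))
  refine le_antisymm (key w₀ w₁ h) (key w₁ w₀ ?_)
  have := (maximalIdeal B).neg_mem_iff.mpr h
  rwa [neg_sub] at this

omit [Fact p.Prime] [IsRegularLocalRing B] [CharP B p] in
/-- At the pole (`w₀ ∈ 𝔪`): `(u·0 − v)^(p−1) = ±v^(p−1)`, so the two-coefficient test reads `v^(p−1) ∉ 𝔪^[p] ∨ u^(p−1) ∉ 𝔪^[p]`. [plumbing] -/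
theorem fedder_pole_iff [IsLocalRing B] (u v : B) :
    ((u * 0 - v) ^ (p - 1) ∉ frobeniusPower p (maximalIdeal B) ∨ u ^ (p - 1) ∉ frobeniusPower p (maximalIdeal B)) ↔
      (v ^ (p - 1) ∉ frobeniusPower p (maximalIdeal B) ∨ u ^ (p - 1) ∉ frobeniusPower p (maximalIdeal B)) := by
  have h : (u * 0 - v) ^ (p - 1) = (-1) ^ (p - 1) * v ^ (p - 1) := by rw [mul_zero, zero_sub, neg_eq_neg_one_mul, mul_pow]
  have hu : IsUnit ((-1 : B) ^ (p - 1)) := (isUnit_one.neg).pow _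
  rw [h, Ideal.unit_mul_mem_iff_mem _ hu]

/-- ★★ **FULL AT EVERY PRIME OVER `𝔪`, POLE / UNIT-POINT FORM** (residue field algebraically closed): `u, v ∈ 𝔪`, `B[X]/(uX − v)` a domain, the two-coefficient test at the UNIT
points `w₀` (`(u w₀ − v)^(p−1) ∉ 𝔪^[p] ∨ u^(p−1) ∉ 𝔪^[p]`) and at the POLE (`v^(p−1) ∉ 𝔪^[p] ∨ u^(p−1) ∉ 𝔪^[p]`) ⇒ `(B[X]/(uX − v))_Q` is `FullCl p` for every prime `Q` over `𝔪`.
This is the form the per-code recipes (✓ `PencilCodeFedder`) feed, for both the `W`-chart `(u, v)` and the `U`-chart `(v, u)`. [OURS · F6 v2 §2; cite: Fedder1983, Thm. 1.12] -/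
theorem fullCl_localization_pencilQuot_of_over' [IsAlgClosed (ResidueField B)] (u v : B) (hu : u ∈ maximalIdeal B) (hv : v ∈ maximalIdeal B)
    (hunit : ∀ w₀ : B, IsUnit w₀ → ((u * w₀ - v) ^ (p - 1) ∉ frobeniusPower p (maximalIdeal B) ∨ u ^ (p - 1) ∉ frobeniusPower p (maximalIdeal B)))
    (hpole : v ^ (p - 1) ∉ frobeniusPower p (maximalIdeal B) ∨ u ^ (p - 1) ∉ frobeniusPower p (maximalIdeal B))
    (hdom : IsDomain (B[X] ⧸ Ideal.span {C u * X - C v}))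
    (Q : Ideal (B[X] ⧸ Ideal.span {C u * X - C v})) [Q.IsPrime]
    (hQ : (Q.comap (Ideal.Quotient.mk (Ideal.span {C u * X - C v}))).comap (C : B →+* B[X]) = maximalIdeal B) :
    FullCl p (Localization.AtPrime Q) := by
  haveI : IsDomain B := isDomain_of_isRegularLocalRing B
  have hpole' := (fedder_pole_iff p u v).mpr hpole
  -- the Fedder disjunction at EVERY `w₀`, after moving `w₀ ∈ 𝔪` to the pole
  have hpt : ∀ w₀ : B, ∃ w₁ : B, (maximalIdeal B).map (C : B →+* B[X]) ⊔ Ideal.span {X - C w₀} = (maximalIdeal B).map (C : B →+* B[X]) ⊔ Ideal.span {X - C w₁} ∧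
      ((u * w₁ - v) ^ (p - 1) ∉ frobeniusPower p (maximalIdeal B) ∨ u ^ (p - 1) ∉ frobeniusPower p (maximalIdeal B)) := by
    intro w₀
    by_cases hw : IsUnit w₀
    · exact ⟨w₀, rfl, hunit w₀ hw⟩
    · refine ⟨0, pointIdeal_congr w₀ 0 (by rw [sub_zero]; exact (mem_maximalIdeal _).mpr hw), hpole'⟩
  haveI : (Q.comap (Ideal.Quotient.mk (Ideal.span {C u * X - C v}))).IsPrime := Ideal.comap_isPrime _ Q
  rcases eq_map_C_or_exists_point (Q.comap (Ideal.Quotient.mk (Ideal.span {C u * X - C v}))) hQ with hgen | ⟨w₀, hw₀⟩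
  · -- generic point of the fibre line: localize the pole
    have hfQ₀' : C u * X - C v ∈ (maximalIdeal B).map (C : B →+* B[X]) ⊔ Ideal.span {X - C 0} := pencil_mem_pointIdeal u v 0 hu hv
    have hker : RingHom.ker (Ideal.Quotient.mk (Ideal.span {C u * X - C v})) ≤ (maximalIdeal B).map (C : B →+* B[X]) ⊔ Ideal.span {X - C 0} := by
      rw [Ideal.mk_ker]; exact (Ideal.span_singleton_le_iff_mem _).mpr hfQ₀'
    haveI hQ₀'max : ((maximalIdeal B).map (C : B →+* B[X]) ⊔ Ideal.span {X - C 0}).IsMaximal := isMaximal_pointIdeal 0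
    haveI hQ₀p : (((maximalIdeal B).map (C : B →+* B[X]) ⊔ Ideal.span {X - C 0}).map (Ideal.Quotient.mk (Ideal.span {C u * X - C v}))).IsPrime :=
      Ideal.map_isPrime_of_surjective Ideal.Quotient.mk_surjective hker
    have hQ₀c : (((maximalIdeal B).map (C : B →+* B[X]) ⊔ Ideal.span {X - C 0}).map (Ideal.Quotient.mk (Ideal.span {C u * X - C v}))).comap
        (Ideal.Quotient.mk (Ideal.span {C u * X - C v})) = (maximalIdeal B).map (C : B →+* B[X]) ⊔ Ideal.span {X - C 0} := by
      rw [Ideal.comap_map_of_surjective _ Ideal.Quotient.mk_surjective, sup_eq_left]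
      exact le_trans (fun z hz => hz) hker
    have hfull₀ := fullCl_localization_pencilQuot_pointIdeal p u v 0 hu hv hpole' hdom _ hQ₀c
    obtain ⟨Q₀, hQ₀p', hQ₀def⟩ : ∃ Q₀ : Ideal (B[X] ⧸ Ideal.span {C u * X - C v}), Q₀.IsPrime ∧
        Q₀ = ((maximalIdeal B).map (C : B →+* B[X]) ⊔ Ideal.span {X - C 0}).map (Ideal.Quotient.mk (Ideal.span {C u * X - C v})) := ⟨_, hQ₀p, rfl⟩
    haveI := hQ₀p'
    have hfull₀' : FullCl p (Localization.AtPrime Q₀) := by subst hQ₀def; exact hfull₀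
    have hle : Q ≤ Q₀ := by
      have h1 : Q = (Q.comap (Ideal.Quotient.mk (Ideal.span {C u * X - C v}))).map (Ideal.Quotient.mk (Ideal.span {C u * X - C v})) :=
        (Ideal.map_comap_of_surjective _ Ideal.Quotient.mk_surjective Q).symm
      rw [h1, hgen, hQ₀def]
      exact Ideal.map_mono le_sup_left
    haveI : CharP (B[X] ⧸ Ideal.span {C u * X - C v}) p :=
      CharP.of_ringHom_of_ne_zero (Ideal.Quotient.mk (Ideal.span {C u * X - C v})) p (Fact.out : p.Prime).ne_zero
    exact fullCl_localization_of_le p Q Q₀ hle hfull₀'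
  · obtain ⟨w₁, hw₁, hfed⟩ := hpt w₀
    rw [hw₁] at hw₀
    exact fullCl_localization_pencilQuot_pointIdeal p u v w₁ hu hv hfed hdom Q hw₀

end Summit.ResolutionOfSingularities.ResolutionOfSingularities.Theorems.FInjectiveMacaulayfication.PencilFedderRegularBasePole

end
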